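import Summits.QuantumFields.YangMills.Theorems.ToronSmallBallOwnAxisShiftDomination
import Summits.QuantumFields.YangMills.Theorems.QuantileBitPuritySectors
import HarnessLib

/-!
# The own-axis sheet shift: counting the disjoint images — the off-core strip carries at most `2C/K` of the periodic sector

Support module (`--supports` stmt-QuantumFields-24089, `ToronSmallBall.PeriodicOffCoreStripWindowDeep`; seat ym-dw-p1 g15).  Fixed lattice, fixed `β ≥ 0`,
ring of `n+1` slices through the untwisted seam.  With the off-core strip `A = {|polDist U₀ − polDist(S U₀)| ≤ w, c₀ < polDist U₀}` of slice `0`,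
the good-field event `G = goodEvent n 0 s t`, a non-centrality floor `σ` (`0 < σ ≤ 1`, `σ ≤ c₀/2 − 2L²√s − nLt`), an angular step `θ' > 5w` and
`K ≥ 1` shifts with `Kθ' ≤ min(σ/2, π/2)`, and a uniform bound `C` on the domination constants of all shifts `|θ| ≤ Kθ'`
(`ToronSmallBallOwnAxisShiftDomination`):

* `sectorWeight_strip_inter_good_le`: `W₀(𝟙_{A ∩ G}) ≤ 2 (C/K) · W₀(1)` — each hemisphere half of `A ∩ G` is dominated by the `K` pairwise disjoint
  images `B±((k+1)θ')`, `k < K` (`TT.sectorWeight_indicator_le_div_of_disjoint`);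
* ★ `sectorWeight_strip_le`: `W₀(𝟙_A(U₀)) ≤ 2 (C/K) · W₀(1) + W₀(𝟙_{Gᶜ})` (the slice-`0` functional of the crux, sub-additivity of sector weights).

HONEST FRAMING: fixed-lattice bookkeeping; nothing about infinite volume, the continuum limit or the Clay gap.  No `sorry`, no new axiom, no new
definition.  References: [cite: Luscher1983, §2]; [cite: MadrasSokal1988, §2]; [cite: MontvayMunster1994, (3.145)].
-/

set_option autoImplicit false

noncomputable section

open MeasureTheory Set Function
open scoped BigOperators
open Literature.MathematicalPhysics.QuantumLattice (su2Quat su2Quat_ne_zero norm_su2Quat)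
open Literature.MathematicalPhysics.QuantumFieldTheory hiding su2Quat_mul
open Literature.MathematicalPhysics.QuantumFieldTheory.Balaban1983to89.T4HaarSU2Translate (continuous_su2Quat)

namespace Summit.QuantumFields.YangMills.Theorems.FemtoTransferGap.OwnAxis

open ClassShift FlatSheet
open Summit.QuantumFields.YangMills.Theorems.FemtoTransferGap.TT

variable {L : ℕ} [NeZero L]

/-! ## §1 Measurability of the events -/

/-- The strip ∩ good ∩ hemisphere events are measurable. [folklore] -/
theorem measurableSet_stripGood (n : ℕ) (s t w c₀ : ℝ) (P : ℝ → Prop) (hP : MeasurableSet {x : ℝ | P x}) :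
    MeasurableSet {p : (Site 3 L → SU2) × (Fin (n + 1) → GaugeConfig 3 L SU2) |
      p ∈ goodEvent n (fun _ => false) s t ∧
      (|polDist (p.2 0) - polDist (configPerm (Equiv.swap (0 : Fin 3) 1) (p.2 0))| ≤ w ∧ c₀ < polDist (p.2 0)) ∧ P (su2Quat (polyX (p.2 0))).re} := by
  have hproj : Measurable fun p : (Site 3 L → SU2) × (Fin (n + 1) → GaugeConfig 3 L SU2) => p.2 0 := (measurable_pi_apply 0).comp measurable_snd
  have h1 : MeasurableSet {p : (Site 3 L → SU2) × (Fin (n + 1) → GaugeConfig 3 L SU2) | p ∈ goodEvent n (fun _ => false) s t} :=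
    measurableSet_goodEvent (L := L) n _ s t
  have h2 : MeasurableSet {p : (Site 3 L → SU2) × (Fin (n + 1) → GaugeConfig 3 L SU2) |
      |polDist (p.2 0) - polDist (configPerm (Equiv.swap (0 : Fin 3) 1) (p.2 0))| ≤ w ∧ c₀ < polDist (p.2 0)} := hproj (measurableSet_strip' (L := L) w c₀)
  have h3 : MeasurableSet {p : (Site 3 L → SU2) × (Fin (n + 1) → GaugeConfig 3 L SU2) | P (su2Quat (polyX (p.2 0))).re} :=
    (measurable_re_su2Quat_polyX.comp hproj) hP
  rw [measurableSet_setOf] at h1 h2 h3 ⊢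
  exact h1.and (h2.and h3)

/-- The angular-translate events `B(θ)` are measurable (for a measurable hemisphere condition). [folklore] -/
theorem measurableSet_B (n : ℕ) (w c₀ θ : ℝ) (P : ℝ → Prop) (hP : MeasurableSet {x : ℝ | P x}) :
    MeasurableSet {p : (Site 3 L → SU2) × (Fin (n + 1) → GaugeConfig 3 L SU2) |
      P (Real.arccos (su2Quat (polyX (p.2 0))).re - θ) ∧
      |Real.sqrt (4 - 4 * |Real.cos (Real.arccos (su2Quat (polyX (p.2 0))).re - θ)|) - polDist (configPerm (Equiv.swap (0 : Fin 3) 1) (p.2 0))| ≤ w ∧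
      c₀ < Real.sqrt (4 - 4 * |Real.cos (Real.arccos (su2Quat (polyX (p.2 0))).re - θ)|)} := by
  have hproj : Measurable fun p : (Site 3 L → SU2) × (Fin (n + 1) → GaugeConfig 3 L SU2) => p.2 0 := (measurable_pi_apply 0).comp measurable_snd
  have hr : Measurable fun p : (Site 3 L → SU2) × (Fin (n + 1) → GaugeConfig 3 L SU2) => Real.arccos (su2Quat (polyX (p.2 0))).re - θ :=
    (Real.continuous_arccos.measurable.comp (measurable_re_su2Quat_polyX.comp hproj)).sub measurable_const
  have hg : Measurable fun p : (Site 3 L → SU2) × (Fin (n + 1) → GaugeConfig 3 L SU2) =>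
      Real.sqrt (4 - 4 * |Real.cos (Real.arccos (su2Quat (polyX (p.2 0))).re - θ)|) :=
    (measurable_const.sub ((Real.continuous_cos.measurable.comp hr).abs.const_mul _)).sqrt
  have hpdS : Measurable fun p : (Site 3 L → SU2) × (Fin (n + 1) → GaugeConfig 3 L SU2) => polDist (configPerm (Equiv.swap (0 : Fin 3) 1) (p.2 0)) :=
    (measurable_polDist.comp (configPerm (Equiv.swap (0 : Fin 3) 1)).measurable).comp hproj
  have h1 : MeasurableSet {p : (Site 3 L → SU2) × (Fin (n + 1) → GaugeConfig 3 L SU2) | P (Real.arccos (su2Quat (polyX (p.2 0))).re - θ)} := hr hP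
  have h3 := measurableSet_le ((hg.sub hpdS).abs) (measurable_const (a := w))
  have h4 := measurableSet_lt (measurable_const (a := c₀)) hg
  rw [measurableSet_setOf] at h1 h3 h4 ⊢
  exact h1.and (h3.and h4)

/-- The two hemisphere conditions are measurable subsets of `ℝ`. [folklore] -/
theorem measurableSet_Icc' (a b : ℝ) : MeasurableSet {x : ℝ | a ≤ x ∧ x ≤ b} := by
  have : {x : ℝ | a ≤ x ∧ x ≤ b} = Set.Icc a b := by ext x; simp [Set.mem_Icc]
  rw [this]; exact measurableSet_Icc

/-! ## §2 Sub-additivity of sector weights of indicators -/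

/-- `W_z(𝟙_E) ≤ W_z(𝟙_F) + W_z(𝟙_G)` whenever `E ⊆ F ∪ G` (measurable sets on (seam field) × slices). [folklore] -/
theorem sectorWeight_indicator_le_add (β : ℝ) (n : ℕ) (z : Fin 3 → Bool)
    {E F G : Set ((Site 3 L → SU2) × (Fin (n + 1) → GaugeConfig 3 L SU2))} (hE : MeasurableSet E) (hF : MeasurableSet F) (hG : MeasurableSet G)
    (hsub : E ⊆ F ∪ G) :
    sectorWeight β n z (fun Us g => E.indicator (fun _ => (1 : ℝ)) (g, Us)) ≤
      sectorWeight β n z (fun Us g => F.indicator (fun _ => (1 : ℝ)) (g, Us)) + sectorWeight β n z (fun Us g => G.indicator (fun _ => (1 : ℝ)) (g, Us)) := by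
  have hsw : Measurable fun q : (Fin (n + 1) → GaugeConfig 3 L SU2) × (Site 3 L → SU2) => (q.2, q.1) := measurable_snd.prodMk measurable_fst
  have hmE : Measurable (uncurry fun (Us : Fin (n + 1) → GaugeConfig 3 L SU2) (g : Site 3 L → SU2) => E.indicator (fun _ => (1 : ℝ)) (g, Us)) :=
    (measurable_const.indicator hE).comp hsw
  have hmF : Measurable (uncurry fun (Us : Fin (n + 1) → GaugeConfig 3 L SU2) (g : Site 3 L → SU2) => F.indicator (fun _ => (1 : ℝ)) (g, Us)) :=
    (measurable_const.indicator hF).comp hsw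
  have hmG : Measurable (uncurry fun (Us : Fin (n + 1) → GaugeConfig 3 L SU2) (g : Site 3 L → SU2) => G.indicator (fun _ => (1 : ℝ)) (g, Us)) :=
    (measurable_const.indicator hG).comp hsw
  rw [← sectorWeight_add β n z hmF hmG (fun Us g => abs_indicator_one_le F (g, Us)) (fun Us g => abs_indicator_one_le G (g, Us))]
  refine sectorWeight_mono β n z hmE (hmF.add hmG) (C := 1 + 1) (fun Us g => (abs_indicator_one_le E (g, Us)).trans (by norm_num))
    (fun Us g => (abs_add_le _ _).trans (add_le_add (abs_indicator_one_le F (g, Us)) (abs_indicator_one_le G (g, Us)))) fun Us g => ?_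
  by_cases hp : (g, Us) ∈ E
  · rw [Set.indicator_of_mem hp]
    rcases hsub hp with hpF | hpG
    · rw [Set.indicator_of_mem hpF]; linarith [Set.indicator_nonneg (fun _ _ => (zero_le_one : (0 : ℝ) ≤ 1)) (g, Us) (s := G)]
    · rw [Set.indicator_of_mem hpG]; linarith [Set.indicator_nonneg (fun _ _ => (zero_le_one : (0 : ℝ) ≤ 1)) (g, Us) (s := F)]
  · rw [Set.indicator_of_notMem hp]
    exact add_nonneg (Set.indicator_nonneg (fun _ _ => zero_le_one) _) (Set.indicator_nonneg (fun _ _ => zero_le_one) _)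

/-! ## §3 Counting -/

/-- ★ **The off-core strip inside the good event carries at most `2C/K` of the periodic sector.** [cite: Luscher1983, §2] [cite: MadrasSokal1988, §2] -/
theorem sectorWeight_strip_inter_good_le {β : ℝ} (hβ : 0 ≤ β) (n : ℕ) {s t w c₀ σ θ' C : ℝ} {K : ℕ} (hK : 1 ≤ K)
    (hσ : 0 < σ) (hσ1 : σ ≤ 1) (hσle : σ ≤ c₀ / 2 - 2 * (L * (L * Real.sqrt s)) - n * (L * t))
    (hw : 0 ≤ w) (hθ' : 5 * w < θ') (hKσ : K * θ' ≤ σ / 2) (hKπ : K * θ' ≤ Real.pi / 2) (hC : 0 ≤ C)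
    (hCθ : ∀ θ : ℝ, |θ| ≤ K * θ' →
      Real.exp (β * ((n + 1 : ℕ) * (Fintype.card (Plaquette 3 L) * ((|θ| * (2 * (L * Real.sqrt s) / σ)) ^ 2 + 2 * (|θ| * (2 * (L * Real.sqrt s) / σ)) * Real.sqrt s) +
          Fintype.card (Edge 3 L) * ((|θ| * (2 * (L * t) / σ)) ^ 2 + 2 * (|θ| * (2 * (L * t) / σ)) * t)))) *
        ((((1 - |θ| / σ) ^ 2)⁻¹) ^ (Finset.univ.filter (fun x : Site 3 L => x 0 = 0)).card) ^ (n + 1) ≤ C) :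
    sectorWeight β n (fun _ => false) (fun Us g =>
        {p : (Site 3 L → SU2) × (Fin (n + 1) → GaugeConfig 3 L SU2) |
          p ∈ goodEvent n (fun _ => false) s t ∧
          (|polDist (p.2 0) - polDist (configPerm (Equiv.swap (0 : Fin 3) 1) (p.2 0))| ≤ w ∧ c₀ < polDist (p.2 0))}.indicator (fun _ => (1 : ℝ)) (g, Us)) ≤
      2 * (C / K) * sectorWeight (L := L) β n (fun _ => false) (fun _ _ => (1 : ℝ)) := by
  have hθ'0 : 0 < θ' := by linarith
  have hK1 : (1 : ℝ) ≤ K := by exact_mod_cast hK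
  -- the shift angles `θ_k = (k+1) θ'`, `k < K`, are admissible
  have hθk : ∀ k : ℕ, k < K → ((k + 1 : ℕ) : ℝ) * θ' ≤ K * θ' := fun k hk =>
    mul_le_mul_of_nonneg_right (by exact_mod_cast hk) hθ'0.le
  have hθk0 : ∀ k : ℕ, 0 ≤ ((k + 1 : ℕ) : ℝ) * θ' := fun k => by positivity
  -- the two halves
  have hlower := sectorWeight_indicator_le_div_of_disjoint (L := L) β n (fun _ => false)
    (measurableSet_stripGood (L := L) n s t w c₀ (fun x => 0 ≤ x) (measurableSet_Ici (a := (0 : ℝ)))) hK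
    (fun k => measurableSet_B (L := L) n w c₀ (((k + 1 : ℕ) : ℝ) * θ') (fun x => 0 ≤ x ∧ x ≤ Real.pi / 2) (measurableSet_Icc' 0 (Real.pi / 2)))
    (B_disjoint_lower (L := L) n hw hθ') hC (fun k hk => by
      have hθ := hθk k hk
      have h := sectorWeight_stripLower_le (L := L) hβ n (s := s) (t := t) (w := w) (c₀ := c₀) hσ hσ1 hσle (hθk0 k) (by linarith) (by linarith)
      refine h.trans (mul_le_mul_of_nonneg_right (hCθ _ (by rw [abs_of_nonneg (hθk0 k)]; exact hθ)) ?_)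
      exact sectorWeight_nonneg β n _ fun Us g => Set.indicator_nonneg (fun _ _ => zero_le_one) _)
  have hupper := sectorWeight_indicator_le_div_of_disjoint (L := L) β n (fun _ => false)
    (measurableSet_stripGood (L := L) n s t w c₀ (fun x => x ≤ 0) (measurableSet_Iic (a := (0 : ℝ)))) hK
    (fun k => measurableSet_B (L := L) n w c₀ (-(((k + 1 : ℕ) : ℝ) * θ')) (fun x => Real.pi / 2 ≤ x ∧ x ≤ Real.pi) (measurableSet_Icc' (Real.pi / 2) Real.pi))
    (B_disjoint_upper (L := L) n hw hθ') hC (fun k hk => by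
      have hθ := hθk k hk
      have h := sectorWeight_stripUpper_le (L := L) hβ n (s := s) (t := t) (w := w) (c₀ := c₀) (θ := -(((k + 1 : ℕ) : ℝ) * θ')) hσ hσ1 hσle
        (by linarith [hθk0 k]) (by rw [neg_neg]; linarith) (by rw [neg_neg]; linarith)
      refine h.trans (mul_le_mul_of_nonneg_right (hCθ _ (by rw [abs_neg, abs_of_nonneg (hθk0 k)]; exact hθ)) ?_)
      exact sectorWeight_nonneg β n _ fun Us g => Set.indicator_nonneg (fun _ _ => zero_le_one) _)
  -- every configuration is in one of the two hemispheres
  have hsplit := sectorWeight_indicator_le_add (L := L) β n (fun _ => false)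
    (measurableSet_stripGood (L := L) n s t w c₀ (fun _ => True) (by simp))
    (measurableSet_stripGood (L := L) n s t w c₀ (fun x => 0 ≤ x) (measurableSet_Ici (a := (0 : ℝ))))
    (measurableSet_stripGood (L := L) n s t w c₀ (fun x => x ≤ 0) (measurableSet_Iic (a := (0 : ℝ))))
    (fun p hp => by
      obtain ⟨hg, hs, -⟩ := hp
      rcases le_total 0 (su2Quat (polyX (p.2 0))).re with h | h
      · exact Or.inl ⟨hg, hs, h⟩
      · exact Or.inr ⟨hg, hs, h⟩)
  have hsame : (fun (Us : Fin (n + 1) → GaugeConfig 3 L SU2) (g : Site 3 L → SU2) =>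
      {p : (Site 3 L → SU2) × (Fin (n + 1) → GaugeConfig 3 L SU2) |
        p ∈ goodEvent n (fun _ => false) s t ∧
        (|polDist (p.2 0) - polDist (configPerm (Equiv.swap (0 : Fin 3) 1) (p.2 0))| ≤ w ∧ c₀ < polDist (p.2 0))}.indicator (fun _ => (1 : ℝ)) (g, Us)) =
      fun Us g => {p : (Site 3 L → SU2) × (Fin (n + 1) → GaugeConfig 3 L SU2) |
        p ∈ goodEvent n (fun _ => false) s t ∧
        (|polDist (p.2 0) - polDist (configPerm (Equiv.swap (0 : Fin 3) 1) (p.2 0))| ≤ w ∧ c₀ < polDist (p.2 0)) ∧ True}.indicator (fun _ => (1 : ℝ)) (g, Us) := by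
    funext Us g; simp only [and_true]
  rw [hsame]
  linarith

omit [NeZero L] in
/-- The slice-`0` functional of a slice event equals the indicator of its cylinder on (seam field) × slices. [folklore] -/
theorem indicator_slice_zero_eq {n : ℕ} (A : Set (GaugeConfig 3 L SU2)) (Us : Fin (n + 1) → GaugeConfig 3 L SU2) (g : Site 3 L → SU2) :
    A.indicator (fun _ => (1 : ℝ)) (Us 0) =
      {p : (Site 3 L → SU2) × (Fin (n + 1) → GaugeConfig 3 L SU2) | p.2 0 ∈ A}.indicator (fun _ => (1 : ℝ)) (g, Us) := by
  by_cases h : Us 0 ∈ A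
  · rw [Set.indicator_of_mem h, Set.indicator_of_mem (show (g, Us) ∈ {p : (Site 3 L → SU2) × (Fin (n + 1) → GaugeConfig 3 L SU2) | p.2 0 ∈ A} from h)]
  · rw [Set.indicator_of_notMem h, Set.indicator_of_notMem (show (g, Us) ∉ {p : (Site 3 L → SU2) × (Fin (n + 1) → GaugeConfig 3 L SU2) | p.2 0 ∈ A} from h)]

/-- ★ **The off-core strip of slice `0` in the periodic sector**: `W₀(𝟙_A(U₀)) ≤ 2(C/K)·W₀(1) + W₀(𝟙_{Gᶜ})`. [cite: Luscher1983, §2] [cite: MadrasSokal1988, §2] -/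
theorem sectorWeight_strip_le {β : ℝ} (hβ : 0 ≤ β) (n : ℕ) {s t w c₀ σ θ' C : ℝ} {K : ℕ} (hK : 1 ≤ K)
    (hσ : 0 < σ) (hσ1 : σ ≤ 1) (hσle : σ ≤ c₀ / 2 - 2 * (L * (L * Real.sqrt s)) - n * (L * t))
    (hw : 0 ≤ w) (hθ' : 5 * w < θ') (hKσ : K * θ' ≤ σ / 2) (hKπ : K * θ' ≤ Real.pi / 2) (hC : 0 ≤ C)
    (hCθ : ∀ θ : ℝ, |θ| ≤ K * θ' →
      Real.exp (β * ((n + 1 : ℕ) * (Fintype.card (Plaquette 3 L) * ((|θ| * (2 * (L * Real.sqrt s) / σ)) ^ 2 + 2 * (|θ| * (2 * (L * Real.sqrt s) / σ)) * Real.sqrt s) +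
          Fintype.card (Edge 3 L) * ((|θ| * (2 * (L * t) / σ)) ^ 2 + 2 * (|θ| * (2 * (L * t) / σ)) * t)))) *
        ((((1 - |θ| / σ) ^ 2)⁻¹) ^ (Finset.univ.filter (fun x : Site 3 L => x 0 = 0)).card) ^ (n + 1) ≤ C) :
    sectorWeight β n (fun _ => false) (fun Us _ =>
        {U : GaugeConfig 3 L SU2 | |polDist U - polDist (configPerm (Equiv.swap (0 : Fin 3) 1) U)| ≤ w ∧ c₀ < polDist U}.indicator (fun _ => (1 : ℝ)) (Us 0)) ≤
      2 * (C / K) * sectorWeight (L := L) β n (fun _ => false) (fun _ _ => (1 : ℝ)) +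
        sectorWeight β n (fun _ => false) (fun Us g => (goodEvent (L := L) n (fun _ => false) s t)ᶜ.indicator (fun _ => (1 : ℝ)) (g, Us)) := by
  have hproj : Measurable fun p : (Site 3 L → SU2) × (Fin (n + 1) → GaugeConfig 3 L SU2) => p.2 0 := (measurable_pi_apply 0).comp measurable_snd
  have hcyl : MeasurableSet {p : (Site 3 L → SU2) × (Fin (n + 1) → GaugeConfig 3 L SU2) |
      p.2 0 ∈ {U : GaugeConfig 3 L SU2 | |polDist U - polDist (configPerm (Equiv.swap (0 : Fin 3) 1) U)| ≤ w ∧ c₀ < polDist U}} :=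
    hproj (measurableSet_strip' (L := L) w c₀)
  have hAG : MeasurableSet {p : (Site 3 L → SU2) × (Fin (n + 1) → GaugeConfig 3 L SU2) |
      p ∈ goodEvent n (fun _ => false) s t ∧
      (|polDist (p.2 0) - polDist (configPerm (Equiv.swap (0 : Fin 3) 1) (p.2 0))| ≤ w ∧ c₀ < polDist (p.2 0))} := by
    have h := measurableSet_stripGood (L := L) n s t w c₀ (fun _ => True) (by simp)
    simp only [and_true] at h
    exact h
  have hsplit := sectorWeight_indicator_le_add (L := L) β n (fun _ => false) hcyl hAG (measurableSet_goodEvent (L := L) n _ s t).compl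
    (fun p hp => by
      by_cases hg : p ∈ goodEvent n (fun _ => false) s t
      · exact Or.inl ⟨hg, hp⟩
      · exact Or.inr hg)
  have hmain := sectorWeight_strip_inter_good_le (L := L) hβ n hK hσ hσ1 hσle hw hθ' hKσ hKπ hC hCθ
  have hfun : (fun (Us : Fin (n + 1) → GaugeConfig 3 L SU2) (_g : Site 3 L → SU2) =>
      {U : GaugeConfig 3 L SU2 | |polDist U - polDist (configPerm (Equiv.swap (0 : Fin 3) 1) U)| ≤ w ∧ c₀ < polDist U}.indicator (fun _ => (1 : ℝ)) (Us 0)) =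
      fun Us g => {p : (Site 3 L → SU2) × (Fin (n + 1) → GaugeConfig 3 L SU2) |
        p.2 0 ∈ {U : GaugeConfig 3 L SU2 | |polDist U - polDist (configPerm (Equiv.swap (0 : Fin 3) 1) U)| ≤ w ∧ c₀ < polDist U}}.indicator
          (fun _ => (1 : ℝ)) (g, Us) := by
    funext Us g; exact indicator_slice_zero_eq _ Us g
  rw [hfun]
  linarith

end Summit.QuantumFields.YangMills.Theorems.FemtoTransferGap.OwnAxis

end
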